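import Literature.AlgebraicGeometry.Motives.AbelianVarietyConjugateBaseChangeAlong
import Literature.AlgebraicGeometry.Motives.AbelianVarietyWeilPairingAlgClosure
import Literature.AlgebraicGeometry.Motives.AbelianVarietyWeilPairingConjugate
import HarnessLib

/-!
# Weil pairings along a homomorphism `κ : A → A^γ` that acts as `σ`-conjugation on torsion:
# `ē^{κ^* X^γ} = (ē^X)^q` (Shimura 1998, proof of Thm. 18.6, p. 130)

Layer `Literature/AlgebraicGeometry/Motives`, namespace `Literature.AlgebraicGeometry.Motives.AbelianVariety`.
KERNEL ONLY: one theorem; no definition, no instance, no named fact, no `sorry`.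

Setting: `A` an abelian variety over a field `k`, `γ ∈ Aut k`, a field extension `k → S` and `σ ∈ Aut S` EXTENDING
`γ`, so that `(A^γ) ⊗_k S ≅ (A ⊗_k S)^σ` (`conjugateBaseChangeAlongIso`, `Motives/AbelianVarietyConjugateBaseChangeAlong`);
a homomorphism `κ : A → A^γ` over `k` which ON THE `N`-TORSION OF `A_S(S)` IS `σ`-CONJUGATION, `κ x = x^σ` (read through
that isomorphism; in Shimura's proof `κ̃ = π` is the Frobenius and «`t^σ = κt`» for the torsion points, p. 130 L9), and
`σ ζ = ζ^q` on the `N`-th roots of unity of `S` (`σ` a `q`-Frobenius).  THEN for every Cartier divisor `X` on `A`,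
with `X^γ = π_γ^* X` its conjugate on `A^γ`,

  **`ē_N^{(κ^* X^γ)_S}(x, y) = ē_N^{X_S}(x, y)^q`** for all `x, y ∈ A_S[N](S)`

(`weilPairingLevel_pullback_conjugate_eq_pow`): `ē^{κ^*X^γ}(x, y) = ē^{X^γ}(κx, κy)` (Mumford §20 (3),
`Motives/AbelianVarietyWeilPairingPullback`) `= ē^{(X_S)^σ}(x^σ, y^σ)` (same divisor along the exchange isomorphism)
`= σ(ē^{X_S}(x, y))` (transport of structure, `Motives/AbelianVarietyWeilPairingConjugate`) `= ē^{X_S}(x, y)^q`.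
This is the reduction-free form of Shimura's «`E_ℓ(κ⁻¹(X^σ)) = E_ℓ(pX)`» (p. 130 L4) once «`t^σ = κt`» is known on
all of `A[ℓᵏ]`; with `Motives/AbelianVarietyWeilPairingAlgClosure` (`weilPairingLevel_map_eq_pow_of_algClosure`) it is
read on complex points (cell `hodgecm-mathlib`, row II-1 `shimura1998_thm18_6`, stub S5 C′₁ + (G), B-p20).

## References
* [Shimura1998] G. Shimura, *Abelian Varieties with Complex Multiplication and Modular Functions* (1998), §18.6,
  proof of Thm. 18.6, p. 130.
* [Milne1986AbelianVarieties] J. S. Milne, *Abelian Varieties* (1986), §16.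
* [MumfordAV1970] D. Mumford, *Abelian Varieties* (1970), §20 p. 186.
-/

universe u

open CategoryTheory CategoryTheory.Limits AlgebraicGeometry

noncomputable section

namespace Literature.AlgebraicGeometry.Motives

namespace AbelianVariety

/-- **The reduction-free transport step on `L̄`-points**: for `κ : A → A^γ` over `k`, an extension `k → S`,
`σ ∈ Aut S` extending `γ` with `σ ζ = ζ^q` on `N`-th roots of unity, and `κ x = x^σ` on `A_S[N](S)` (read through
`(A^γ)_S ≅ (A_S)^σ`), every divisor `X` on `A` satisfies `ē_N^{κ^* π_γ^* X}(x, y) = ē_N^{X}(x, y)^q` on `A_S[N](S)`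
(Shimura p. 130: «`r(w)^σ = κ(r(w))`», and `E'(κx, κy)` computed by transport of structure along `σ`;
Milne §16: the `ē_m` are compatible with automorphisms of the ground field).
[cite: Shimura1998, §18.6 proof of Thm. 18.6 (p. 130; held chunk p0168 L3–9)] [cite: Milne1986AbelianVarieties, §16 (p. 131, the pairings ē_m)] -/
theorem weilPairingLevel_pullback_conjugate_eq_pow {k : Type u} [Field k] (S : Type u) [Field S] [Algebra k S]
    (γ : k ≃+* k) (σ : S ≃+* S) (hσ : ∀ x, σ (algebraMap k S x) = algebraMap k S (γ x)) (A : AbelianVariety k)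
    (κ : A ⟶ A.conjugate γ) [IsDominant (Hom.toSchemeHom κ)] [IsDominant (Hom.toSchemeHom (Hom.baseChange S κ))]
    {N : ℕ} (hN : (N : S) ≠ 0) (q : ℕ) (hσζ : ∀ ζ : S, ζ ^ N = 1 → σ ζ = ζ ^ q)
    (πγ : (A.conjugate γ).X.left ⟶ A.X.left) (hπγ : πγ = baseChangeHomFst γ.toRingHom A.X) [IsDominant πγ]
    (πc : (A.baseChange S).X.left ⟶ A.X.left) (hπc : πc = pullback.fst A.X.hom (bcSpec k S)) [IsDominant πc]
    [IsDominant (Hom.toSchemeHom ((N : ℤ) • 𝟙 (A.baseChange S)))]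
    (hκσ : ∀ x : (A.baseChange S).torsionPoints S N,
      AlgPoints.map (conjugateBaseChangeAlongIso γ σ hσ A).hom.hom.hom.hom
          (AlgPoints.map (Hom.baseChange S κ).hom.hom.hom x.1) =
        (A.baseChange S).conjPoints σ x.1)
    (X : CartierDivisor A.X.left) (x y : (A.baseChange S).torsionPoints S N) :
    (A.baseChange S).weilPairingLevel (((X.pullback πγ).pullback (Hom.toSchemeHom κ)).pullback πc) x y =
      (A.baseChange S).weilPairingLevel (X.pullback πc) x y ^ q := by
  -- projections as variables
  obtain ⟨πB, hπB⟩ : ∃ π : ((A.conjugate γ).baseChange S).X.left ⟶ (A.conjugate γ).X.left,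
      π = pullback.fst (A.conjugate γ).X.hom (bcSpec k S) := ⟨_, rfl⟩
  obtain ⟨πσ, hπσ⟩ : ∃ π : ((A.baseChange S).conjugate σ).X.left ⟶ (A.baseChange S).X.left,
      π = baseChangeHomFst σ.toRingHom (A.baseChange S).X := ⟨_, rfl⟩
  haveI : IsDominant πB := by rw [hπB]; exact (A.conjugate γ).isDominant_baseChangeFst S
  haveI : IsDominant πσ := by rw [hπσ]; exact isDominant_baseChangeHomFst σ (A.baseChange S)
  haveI : IsDominant (Hom.toSchemeHom ((N : ℤ) • 𝟙 ((A.conjugate γ).baseChange S))) :=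
    isDominant_toSchemeHom_zsmul_of_ne_zero _ hN
  haveI : IsDominant (Hom.toSchemeHom ((N : ℤ) • 𝟙 ((A.baseChange S).conjugate σ))) :=
    isDominant_toSchemeHom_zsmul_of_ne_zero _ hN
  haveI : IsDominant (Hom.toSchemeHom (conjugateBaseChangeAlongIso γ σ hσ A).hom) :=
    isDominant_toSchemeHom_iso_hom _
  -- (1) `κ_S^* (π_γ^* X)_S` and `(κ^* π_γ^* X)_S` are the same divisor; `ē^{κ_S^* Θ}(x, y) = ē^{Θ}(κ x, κ y)`
  have hsq1 : Hom.toSchemeHom (Hom.baseChange S κ) ≫ πB = πc ≫ Hom.toSchemeHom κ := by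
    rw [hπB, hπc]
    exact toSchemeHom_baseChange_comp_fst S κ
  haveI : IsDominant (Hom.toSchemeHom (Hom.baseChange S κ) ≫ πB) := inferInstance
  haveI : IsDominant (πc ≫ Hom.toSchemeHom κ) := inferInstance
  have hdiv1 : (((X.pullback πγ).pullback πB).pullback (Hom.toSchemeHom (Hom.baseChange S κ))).SameDivisor
      (((X.pullback πγ).pullback (Hom.toSchemeHom κ)).pullback πc) :=
    (((X.pullback πγ).pullback_pullback_sameDivisor _ _).trans ((X.pullback πγ).pullback_congr_sameDivisor hsq1)).trans
      ((X.pullback πγ).pullback_pullback_sameDivisor _ _).symm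
  rw [← weilPairingLevel_congr_sameDivisor hdiv1, weilPairingLevel_pullback (Hom.baseChange S κ)]
  -- (2) along `e : (A^γ)_S ≅ (A_S)^σ`: `(π_γ^* X)_S = e^* ((X_S)^σ)` (both are `X` pulled back to `(A^γ)_S`)
  have hsq2 : Hom.toSchemeHom (conjugateBaseChangeAlongIso γ σ hσ A).hom ≫ πσ ≫ πc = πB ≫ πγ := by
    rw [hπσ, hπc, hπB, hπγ]
    exact toSchemeHom_conjugateBaseChangeAlongIso_hom_comp_fst_fst γ σ hσ A
  haveI : IsDominant (πσ ≫ πc) := inferInstance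
  haveI : IsDominant (Hom.toSchemeHom (conjugateBaseChangeAlongIso γ σ hσ A).hom ≫ πσ ≫ πc) := inferInstance
  haveI : IsDominant (πB ≫ πγ) := inferInstance
  have hdiv2 : (((X.pullback πc).pullback πσ).pullback
      (Hom.toSchemeHom (conjugateBaseChangeAlongIso γ σ hσ A).hom)).SameDivisor ((X.pullback πγ).pullback πB) :=
    (((X.pullback_pullback_sameDivisor _ _).pullback _).trans
      ((X.pullback_pullback_sameDivisor _ _).trans (X.pullback_congr_sameDivisor hsq2))).trans
        (X.pullback_pullback_sameDivisor _ _).symm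
  rw [← weilPairingLevel_congr_sameDivisor hdiv2,
    weilPairingLevel_pullback_eq (conjugateBaseChangeAlongIso γ σ hσ A).hom ((X.pullback πc).pullback πσ)
      ⟨AlgPoints.map (Hom.baseChange S κ).hom.hom.hom x.1, map_mem_torsionPoints (Hom.baseChange S κ) x.2⟩
      ⟨AlgPoints.map (Hom.baseChange S κ).hom.hom.hom y.1, map_mem_torsionPoints (Hom.baseChange S κ) y.2⟩
      ⟨(A.baseChange S).conjPoints σ x.1, (A.baseChange S).conjPoints_mem_torsionPoints σ x.2⟩
      ⟨(A.baseChange S).conjPoints σ y.1, (A.baseChange S).conjPoints_mem_torsionPoints σ y.2⟩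
      (hκσ x).symm (hκσ y).symm]
  -- (3) transport of structure `ē^{X^σ}(x^σ, y^σ) = σ ē^X(x, y)` and (4) `σ ζ = ζ^q` on `μ_N`
  rw [weilPairingLevel_conjugate σ (A.baseChange S) πσ hπσ (X.pullback πc) x y]
  exact hσζ _ (weilPairingLevel_pow_card_eq_one _ x y)

end AbelianVariety

end Literature.AlgebraicGeometry.Motives

end
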